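import Literature.NumberTheory.ModularForms.ParabolicCohomologyGamma0Field
import Literature.NumberTheory.EllipticCurves.ModularSymbolsEichlerShimuraHoldsProofs
import HarnessLib

/-!
# The Eisenstein covector on `H₁(X₀(M), ℤ) ⊗ 𝔽_p` for primes `p ∣ M - 1` (Mazur's Shimura class),
# through parabolic group cohomology — no `q`-expansions

Topic `Literature/NumberTheory/ModularForms`; namespace `Literature.NumberTheory.ModularForms`
(grouping sub-namespace `EisensteinCovector`).  Everything here is PROVED; no named facts.

Let `M` be a prime and `p ≥ 5` a prime dividing `M - 1`.  Mazur (1977, II.9, II.11, II.16–18)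
shows that `p` is an *Eisenstein prime*: the maximal ideal `𝔐 = (p, T_ℓ - 1 - ℓ : ℓ ≠ M)` of the
Hecke algebra `𝕋` of `J₀(M)` is a genuine (proper) ideal, so that there is a weight-`2` cusp form
of level `M` congruent to the Eisenstein series modulo a prime above `p` (the input to the
`(N, k) = (1, 2)` case of Billerey–Menares 2018, Thm. 1).  The usual proof manipulates the
constant term of `E₂` (Mazur II.5).  This file gives a **purely (co)homological proof of the key
support statement**, in the form

* `EisensteinCovector.exists_eisensteinCovector` : for primes `M`, `p ≥ 5` with `p ∣ M - 1` there
  is a non-zero additive `ū : H₁(X₀(M), ℤ) → 𝔽_p` on the period homology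
  `periodHomology M ⊆ S₂(Γ₀(M))^∨` (the tree's `H₁(X₀(M), ℤ)`, Cremona 1997 §2.1) with
  `ū (T_ℓ^∨ x) = (ℓ + 1) ū(x)` for every prime `ℓ ≠ M` —

so `𝔐` lies in the support of the faithful `𝕋`-module `H₁(X₀(M), 𝔽_p)`.  The argument:

1. (§2) The **Shimura class** `u_φ : Γ₀(M) → 𝔽_p`, `(a b; c d) ↦ φ(d mod M)` for a surjective
   character `φ : (ℤ/M)ˣ → ℤ/p` (`exists_character`; Mathlib's `Gamma0Map`), is a homomorphism
   vanishing on parabolic elements (`uClass_eq_zero_of_isParabolic`: a parabolic element of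
   `Γ₀(M)` has `d ≡ ±1`), non-zero (`exists_toHomUnits_eq`), i.e. a non-zero element of
   `H¹_P(Γ₀(M), 𝔽_p)` (`ParabolicCountK.parabolicHoms`), and its Hecke sum over the explicit
   correspondents `δⱼ, δ'` of `γ` (§1, `colB`, `colD`: the elements of `Γ₀(N)` with
   `δ∞ = Mγ∞`, `M ∈ R_ℓ`, written down from first columns as in the tree's
   `exists_gamma0_inftyImage_tpB/tpD`) is `(ℓ + 1) u_φ(γ)` (`sum_uClass_col`: the `a`-entries are
   `≡ a` except at the unique `j` with `ℓ ∣ a + jc`, where `a/ℓ` appears, compensated by `ℓa` in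
   `δ'`).
2. (§1) `T_ℓ^∨ per(γ) = ∑ⱼ per(δⱼ) + 𝟙_{ℓ ∤ N} per(δ')` on period functionals
   (`dualMap_heckeT_periodFunctional_eq`, from the tree's `modularSymbol_heckeT_eq_sum`,
   Cremona 1997 (2.4.1)–(2.4.2)).
3. (§3) **Every `𝔽_p`-valued parabolic cocycle of `Γ₀(N)` factors through the period map**
   `per : Γ₀(N) → H₁(X₀(N), ℤ)` (`exists_addMonoidHom_comp_per`, any `N ≥ 1`, `p ≥ 5`): the
   reductions mod `p` of the `2g` integer coordinates of `per` (`H₁ ≅ ℤ^{2g}`,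
   `periodHomology_eq_span_basis_holds`) are independent parabolic cocycles, and
   `dim H¹_P(Γ₀(N), 𝔽_p) ≤ 2g` (`ParabolicCountK.finrank_parabolicHoms_le`, the mod-`p` Shimura
   count of `ParabolicCohomologyGamma0Field`), so they form a basis.
4. (§4) Transport of the Hecke sum through the factorisation (Manin: `per` is onto).

## References

* B. Mazur, *Modular curves and the Eisenstein ideal*, Publ. Math. IHÉS 47 (1977), II.2, II.9
  (Prop. 9.7), II.11 (the Shimura subgroup), II.16–II.18. [Mazur1977]
* J. E. Cremona, *Algorithms for modular elliptic curves*, 2nd ed. (1997), §2.1 (2.1.1),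
  Lemma 2.1.1, §2.4 (2.4.1)–(2.4.2). [CremonaAlgorithms1997]
* A. W. Knapp, *Elliptic curves* (1993), Prop. 11.1, Prop. 11.22. [Knapp1993]
* G. Shimura, *Introduction to the arithmetic theory of automorphic functions* (1971), Prop. 3.36,
  §8.2 (8.2.23). [ShimuraIATAF1971]
* Ju. I. Manin, *Parabolic points and zeta functions of modular curves* (1972), Prop. 1.4. [Manin1972]
* N. Billerey, R. Menares, *Strong modularity of reducible Galois representations*, Trans. AMS 370
  (2018), Thm. 1 (case `(N, k) = (1, 2)`). [BillereyMenares2018]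
-/

noncomputable section

open scoped MatrixGroups
open CongruenceSubgroup Matrix.SpecialLinearGroup ModularGroup Module
open Literature.NumberTheory.EllipticCurves.ModularForms

namespace Literature.NumberTheory.ModularForms

namespace EisensteinCovector

open scoped Classical

/-! ### 1. Explicit Hecke correspondents of `γ`: elements `δ ∈ Γ₀(N)` with `δ∞ = Mγ∞`, `M ∈ R_ℓ` -/

section Columns

variable {N : ℕ} {ℓ : ℕ}

/-- `a + jc` is prime to `c` for `γ = (a b; c d)`. [folklore] -/
theorem isCoprime_add_mul (γ : Gamma0 N) (j : ℤ) :
    IsCoprime ((γ : SL(2, ℤ)) 0 0 + j * (γ : SL(2, ℤ)) 1 0) ((γ : SL(2, ℤ)) 1 0) := by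
  simpa [mul_comm] using (Matrix.SpecialLinearGroup.isCoprime_col (γ : SL(2, ℤ)) 0).add_mul_right_left j

/-- First column `((a + jc)/ℓ, c)` is primitive when `ℓ ∣ a + jc`. [folklore] -/
theorem isCoprime_div (hℓ : ℓ.Prime) (γ : Gamma0 N) (j : ℤ)
    (h : (ℓ : ℤ) ∣ (γ : SL(2, ℤ)) 0 0 + j * (γ : SL(2, ℤ)) 1 0) :
    IsCoprime (((γ : SL(2, ℤ)) 0 0 + j * (γ : SL(2, ℤ)) 1 0) / ℓ) ((γ : SL(2, ℤ)) 1 0) := by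
  have hajc := isCoprime_add_mul γ j
  obtain ⟨u, hu⟩ := h
  have hℓ0 : (ℓ : ℤ) ≠ 0 := by exact_mod_cast hℓ.ne_zero
  rw [hu, Int.mul_ediv_cancel_left _ hℓ0]
  rw [hu, mul_comm] at hajc
  exact hajc.of_mul_left_left

/-- First column `(a + jc, ℓc)` is primitive when `ℓ ∤ a + jc`. [folklore] -/
theorem isCoprime_mul (hℓ : ℓ.Prime) (γ : Gamma0 N) (j : ℤ)
    (h : ¬ (ℓ : ℤ) ∣ (γ : SL(2, ℤ)) 0 0 + j * (γ : SL(2, ℤ)) 1 0) :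
    IsCoprime ((γ : SL(2, ℤ)) 0 0 + j * (γ : SL(2, ℤ)) 1 0) (ℓ * (γ : SL(2, ℤ)) 1 0) :=
  (((Nat.prime_iff_prime_int.mp hℓ).coprime_iff_not_dvd.mpr h).symm).mul_right (isCoprime_add_mul γ j)

/-- **The correspondent `δ_j` of `γ` under `(1 j; 0 ℓ)`**: the element of `Γ₀(N)` with first
column `((a + jc)/ℓ, c)` if `ℓ ∣ a + jc` and `(a + jc, ℓc)` otherwise, so that
`δ_j ∞ = (γ∞ + j)/ℓ` (Shimura 1971, Prop. 3.36; Cremona 1997, §2.4). [folklore] -/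
def colB (hℓ : ℓ.Prime) (γ : Gamma0 N) (j : ℤ) : Gamma0 N :=
  if h : (ℓ : ℤ) ∣ (γ : SL(2, ℤ)) 0 0 + j * (γ : SL(2, ℤ)) 1 0 then
    Gamma0.mkOfCol _ _ (isCoprime_div hℓ γ j h) (dvd_entry_of_mem_Gamma0 N γ.2)
  else
    Gamma0.mkOfCol _ _ (isCoprime_mul hℓ γ j h) ((dvd_entry_of_mem_Gamma0 N γ.2).mul_left _)

/-- Entries of `δ_j` when `ℓ ∣ a + jc`. [folklore] -/
theorem colB_apply_of_dvd (hℓ : ℓ.Prime) (γ : Gamma0 N) (j : ℤ)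
    (h : (ℓ : ℤ) ∣ (γ : SL(2, ℤ)) 0 0 + j * (γ : SL(2, ℤ)) 1 0) :
    ((colB hℓ γ j : Gamma0 N) : SL(2, ℤ)) 0 0 = ((γ : SL(2, ℤ)) 0 0 + j * (γ : SL(2, ℤ)) 1 0) / ℓ ∧
      ((colB hℓ γ j : Gamma0 N) : SL(2, ℤ)) 1 0 = (γ : SL(2, ℤ)) 1 0 := by
  rw [colB, dif_pos h]
  exact ⟨rfl, rfl⟩

/-- Entries of `δ_j` when `ℓ ∤ a + jc`. [folklore] -/
theorem colB_apply_of_not_dvd (hℓ : ℓ.Prime) (γ : Gamma0 N) (j : ℤ)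
    (h : ¬ (ℓ : ℤ) ∣ (γ : SL(2, ℤ)) 0 0 + j * (γ : SL(2, ℤ)) 1 0) :
    ((colB hℓ γ j : Gamma0 N) : SL(2, ℤ)) 0 0 = (γ : SL(2, ℤ)) 0 0 + j * (γ : SL(2, ℤ)) 1 0 ∧
      ((colB hℓ γ j : Gamma0 N) : SL(2, ℤ)) 1 0 = ℓ * (γ : SL(2, ℤ)) 1 0 := by
  rw [colB, dif_neg h]
  exact ⟨rfl, rfl⟩

/-- `δ_j ∞ = ∞ ↔ γ ∞ = ∞`. [folklore] -/
theorem colB_one_zero_eq_zero_iff (hℓ : ℓ.Prime) (γ : Gamma0 N) (j : ℤ) :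
    ((colB hℓ γ j : Gamma0 N) : SL(2, ℤ)) 1 0 = 0 ↔ (γ : SL(2, ℤ)) 1 0 = 0 := by
  by_cases h : (ℓ : ℤ) ∣ (γ : SL(2, ℤ)) 0 0 + j * (γ : SL(2, ℤ)) 1 0
  · rw [(colB_apply_of_dvd hℓ γ j h).2]
  · rw [(colB_apply_of_not_dvd hℓ γ j h).2, mul_eq_zero, or_iff_right]
    exact_mod_cast hℓ.ne_zero

/-- `δ_j ∞ = (γ∞ + j)/ℓ`. [folklore] -/
theorem colB_ratio (hℓ : ℓ.Prime) (γ : Gamma0 N) (j : ℤ) (hc : (γ : SL(2, ℤ)) 1 0 ≠ 0) :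
    (((colB hℓ γ j : Gamma0 N) : SL(2, ℤ)) 0 0 : ℚ) / ((colB hℓ γ j : Gamma0 N) : SL(2, ℤ)) 1 0 =
      ((((γ : SL(2, ℤ)) 0 0 : ℚ) / (γ : SL(2, ℤ)) 1 0) + j) / ℓ := by
  have hc' : (((γ : SL(2, ℤ)) 1 0 : ℤ) : ℚ) ≠ 0 := by exact_mod_cast hc
  have hℓ' : (ℓ : ℚ) ≠ 0 := by exact_mod_cast hℓ.ne_zero
  by_cases h : (ℓ : ℤ) ∣ (γ : SL(2, ℤ)) 0 0 + j * (γ : SL(2, ℤ)) 1 0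
  · obtain ⟨e1, e2⟩ := colB_apply_of_dvd hℓ γ j h
    rw [e1, e2]
    obtain ⟨u, hu⟩ := h
    have hℓ0 : (ℓ : ℤ) ≠ 0 := by exact_mod_cast hℓ.ne_zero
    rw [hu, Int.mul_ediv_cancel_left _ hℓ0]
    have hu' : (((γ : SL(2, ℤ)) 0 0 : ℤ) : ℚ) + j * (γ : SL(2, ℤ)) 1 0 = ℓ * u := by exact_mod_cast hu
    field_simp
    linear_combination -hu'
  · obtain ⟨e1, e2⟩ := colB_apply_of_not_dvd hℓ γ j h
    rw [e1, e2]
    push_cast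
    field_simp

/-- **The correspondent `δ'` of `γ` under `diag(ℓ, 1)`** (used only for `ℓ ∤ N`): first column
`(a, c/ℓ)` if `ℓ ∣ c` (then `N ∣ c/ℓ`) and `(ℓa, c)` otherwise, so that `δ' ∞ = ℓ γ∞`; for `ℓ ∣ N`
(where it is not needed) it is `1` in the first case. [folklore] -/
def colD (hℓ : ℓ.Prime) (γ : Gamma0 N) : Gamma0 N :=
  if h : (ℓ : ℤ) ∣ (γ : SL(2, ℤ)) 1 0 then
    if hN : ℓ ∣ N then 1
    else
      Gamma0.mkOfCol ((γ : SL(2, ℤ)) 0 0) ((γ : SL(2, ℤ)) 1 0 / ℓ)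
        (by
          obtain ⟨v, hv⟩ := h
          have hℓ0 : (ℓ : ℤ) ≠ 0 := by exact_mod_cast hℓ.ne_zero
          have hac := Matrix.SpecialLinearGroup.isCoprime_col (γ : SL(2, ℤ)) 0
          rw [hv, Int.mul_ediv_cancel_left _ hℓ0]
          rw [hv] at hac
          exact hac.of_mul_right_right)
        (by
          obtain ⟨v, hv⟩ := h
          have hℓ0 : (ℓ : ℤ) ≠ 0 := by exact_mod_cast hℓ.ne_zero
          rw [hv, Int.mul_ediv_cancel_left _ hℓ0]
          have hNℓ : IsCoprime (N : ℤ) ℓ := by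
            rw [Nat.isCoprime_iff_coprime]
            exact (Nat.Coprime.symm ((Nat.Prime.coprime_iff_not_dvd hℓ).mpr hN))
          exact hNℓ.dvd_of_dvd_mul_left (by rw [← hv]; exact dvd_entry_of_mem_Gamma0 N γ.2))
  else
    Gamma0.mkOfCol (ℓ * (γ : SL(2, ℤ)) 0 0) ((γ : SL(2, ℤ)) 1 0)
      (((Nat.prime_iff_prime_int.mp hℓ).coprime_iff_not_dvd.mpr h).mul_left
        (Matrix.SpecialLinearGroup.isCoprime_col (γ : SL(2, ℤ)) 0))
      (dvd_entry_of_mem_Gamma0 N γ.2)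

/-- Entries of `δ'` when `ℓ ∣ c`, `ℓ ∤ N`. [folklore] -/
theorem colD_apply_of_dvd (hℓ : ℓ.Prime) (hN : ¬ ℓ ∣ N) (γ : Gamma0 N)
    (h : (ℓ : ℤ) ∣ (γ : SL(2, ℤ)) 1 0) :
    ((colD hℓ γ : Gamma0 N) : SL(2, ℤ)) 0 0 = (γ : SL(2, ℤ)) 0 0 ∧
      ((colD hℓ γ : Gamma0 N) : SL(2, ℤ)) 1 0 = (γ : SL(2, ℤ)) 1 0 / ℓ := by
  rw [colD, dif_pos h, dif_neg hN]
  exact ⟨rfl, rfl⟩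

/-- Entries of `δ'` when `ℓ ∤ c`. [folklore] -/
theorem colD_apply_of_not_dvd (hℓ : ℓ.Prime) (γ : Gamma0 N) (h : ¬ (ℓ : ℤ) ∣ (γ : SL(2, ℤ)) 1 0) :
    ((colD hℓ γ : Gamma0 N) : SL(2, ℤ)) 0 0 = ℓ * (γ : SL(2, ℤ)) 0 0 ∧
      ((colD hℓ γ : Gamma0 N) : SL(2, ℤ)) 1 0 = (γ : SL(2, ℤ)) 1 0 := by
  rw [colD, dif_neg h]
  exact ⟨rfl, rfl⟩

/-- `δ' ∞ = ∞ ↔ γ ∞ = ∞` (`ℓ ∤ N`). [folklore] -/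
theorem colD_one_zero_eq_zero_iff (hℓ : ℓ.Prime) (hN : ¬ ℓ ∣ N) (γ : Gamma0 N) :
    ((colD hℓ γ : Gamma0 N) : SL(2, ℤ)) 1 0 = 0 ↔ (γ : SL(2, ℤ)) 1 0 = 0 := by
  by_cases h : (ℓ : ℤ) ∣ (γ : SL(2, ℤ)) 1 0
  · rw [(colD_apply_of_dvd hℓ hN γ h).2]
    obtain ⟨v, hv⟩ := h
    have hℓ0 : (ℓ : ℤ) ≠ 0 := by exact_mod_cast hℓ.ne_zero
    rw [hv, Int.mul_ediv_cancel_left _ hℓ0, mul_eq_zero, or_iff_right hℓ0]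
  · rw [(colD_apply_of_not_dvd hℓ γ h).2]

/-- `δ' ∞ = ℓ γ∞` (`ℓ ∤ N`). [folklore] -/
theorem colD_ratio (hℓ : ℓ.Prime) (hN : ¬ ℓ ∣ N) (γ : Gamma0 N) (hc : (γ : SL(2, ℤ)) 1 0 ≠ 0) :
    (((colD hℓ γ : Gamma0 N) : SL(2, ℤ)) 0 0 : ℚ) / ((colD hℓ γ : Gamma0 N) : SL(2, ℤ)) 1 0 =
      ℓ * ((((γ : SL(2, ℤ)) 0 0 : ℚ) / (γ : SL(2, ℤ)) 1 0)) := by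
  have hℓ' : (ℓ : ℚ) ≠ 0 := by exact_mod_cast hℓ.ne_zero
  by_cases h : (ℓ : ℤ) ∣ (γ : SL(2, ℤ)) 1 0
  · obtain ⟨e1, e2⟩ := colD_apply_of_dvd hℓ hN γ h
    rw [e1, e2]
    obtain ⟨v, hv⟩ := h
    have hℓ0 : (ℓ : ℤ) ≠ 0 := by exact_mod_cast hℓ.ne_zero
    rw [hv, Int.mul_ediv_cancel_left _ hℓ0]
    have hv0 : v ≠ 0 := by
      rintro rfl
      exact hc (by simpa using hv)
    have hv' : (v : ℚ) ≠ 0 := by exact_mod_cast hv0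
    push_cast
    field_simp
  · obtain ⟨e1, e2⟩ := colD_apply_of_not_dvd hℓ γ h
    rw [e1, e2]
    push_cast
    ring

/-- **Hecke operators on periods through the explicit correspondents**:
`{∞, γ∞}_{T_ℓ h} = ∑ⱼ {∞, δⱼ∞}_h + 𝟙_{ℓ ∤ N} {∞, δ'∞}_h` for every `h ∈ S₂(Γ₀(N))`
(Cremona 1997, §2.4, (2.4.1)–(2.4.2); the tree's `exists_cuspSymbol_heckeT` with the witnesses
made explicit). [cite: CremonaAlgorithms1997, §2.4 (2.4.1)–(2.4.2)] -/
theorem cuspSymbol_heckeT_eq_sum_col [NeZero N] [NeZero ℓ] (hℓ : ℓ.Prime) (γ : Gamma0 N)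
    (h : CuspForm (Gamma0 N) 2) :
    cuspSymbol (heckeT (Gamma0 N) 2 ℓ h) γ =
      ∑ j : Fin ℓ, cuspSymbol h (colB hℓ γ ((j : ℕ) : ℤ)) +
        if ℓ ∣ N then 0 else cuspSymbol h (colD hℓ γ) := by
  have key : (γ : SL(2, ℤ)) 1 0 ≠ 0 →
      ∑ j : Fin ℓ, modularSymbol h
          ((((γ : SL(2, ℤ)) 0 0 : ℚ) / ((γ : SL(2, ℤ)) 1 0 : ℚ) + ((j : ℕ) : ℤ)) / ℓ) =
        ∑ j : Fin ℓ, cuspSymbol h (colB hℓ γ ((j : ℕ) : ℤ)) := by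
    intro hc
    refine Finset.sum_congr rfl fun j _ ↦ ?_
    rw [cuspSymbol, if_neg (fun h0 ↦ hc ((colB_one_zero_eq_zero_iff hℓ γ _).mp h0)), colB_ratio hℓ γ _ hc]
  by_cases hℓN : ℓ ∣ N
  · rw [if_pos hℓN, add_zero]
    by_cases hc : (γ : SL(2, ℤ)) 1 0 = 0
    · rw [cuspSymbol, if_pos hc]
      symm
      exact Finset.sum_eq_zero fun j _ ↦ by rw [cuspSymbol, if_pos ((colB_one_zero_eq_zero_iff hℓ γ _).mpr hc)]
    · rw [cuspSymbol, if_neg hc, modularSymbol_heckeT_eq_sum ℓ h hℓ, if_pos hℓN, add_zero]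
      exact key hc
  · rw [if_neg hℓN]
    by_cases hc : (γ : SL(2, ℤ)) 1 0 = 0
    · rw [cuspSymbol, if_pos hc, cuspSymbol, if_pos ((colD_one_zero_eq_zero_iff hℓ hℓN γ).mpr hc),
        add_zero]
      symm
      exact Finset.sum_eq_zero fun j _ ↦ by rw [cuspSymbol, if_pos ((colB_one_zero_eq_zero_iff hℓ γ _).mpr hc)]
    · rw [cuspSymbol, if_neg hc, modularSymbol_heckeT_eq_sum ℓ h hℓ, if_neg hℓN, cuspSymbol,
        if_neg (fun h0 ↦ hc ((colD_one_zero_eq_zero_iff hℓ hℓN γ).mp h0)), colD_ratio hℓ hℓN γ hc, key hc]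

/-- The same on period functionals: `T_ℓ^∨ (h ↦ {∞, γ∞}_h) = ∑ⱼ per(δⱼ) + 𝟙_{ℓ ∤ N} per(δ')`.
[cite: CremonaAlgorithms1997, §2.4 (2.4.2)] -/
theorem dualMap_heckeT_periodFunctional_eq [NeZero N] [NeZero ℓ] (hℓ : ℓ.Prime) (γ : Gamma0 N) :
    (heckeT (Gamma0 N) 2 ℓ).dualMap (periodFunctional N γ) =
      ∑ j : Fin ℓ, periodFunctional N (colB hℓ γ ((j : ℕ) : ℤ)) +
        if ℓ ∣ N then 0 else periodFunctional N (colD hℓ γ) := by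
  ext h
  rw [LinearMap.dualMap_apply, periodFunctional_apply, cuspSymbol_heckeT_eq_sum_col hℓ γ h]
  split_ifs <;> simp

end Columns

/-! ### 2. The Shimura class `u_φ(γ) = φ(d mod N)` -/

section ShimuraClass

variable {N : ℕ} {A : Type*} [AddCommGroup A]

variable (N) in
/-- **The Shimura class** of a character `φ` of `(ℤ/Nℤ)ˣ` (written additively): the homomorphism
`Γ₀(N) → (ℤ/Nℤ)ˣ → A`, `γ = (a b; c d) ↦ φ(d mod N)` — the class of the covering
`X₁(N) → X₀(N)` pushed out along `φ` (Mazur 1977, II.2, the "Shimura subgroup"/covering;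
Mathlib's `Gamma0Map`). [cite: Mazur1977, II.2 and II.11] -/
def uClass (φ : (ZMod N)ˣ →* Multiplicative A) : Gamma0 N → A :=
  fun γ ↦ Multiplicative.toAdd (φ ((Gamma0Map N).toHomUnits γ))

/-- `u_φ` is a homomorphism. [folklore] -/
theorem uClass_mul (φ : (ZMod N)ˣ →* Multiplicative A) (γ δ : Gamma0 N) :
    uClass N φ (γ * δ) = uClass N φ γ + uClass N φ δ := by
  simp [uClass]

/-- The unit `d mod N` of `γ`. [folklore] -/
theorem val_toHomUnits (γ : Gamma0 N) :
    (((Gamma0Map N).toHomUnits γ : (ZMod N)ˣ) : ZMod N) = (((γ : SL(2, ℤ)) 1 1 : ℤ) : ZMod N) := rfl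

/-- Its inverse is `a mod N`. [folklore] -/
theorem val_inv_toHomUnits (γ : Gamma0 N) :
    ((((Gamma0Map N).toHomUnits γ)⁻¹ : (ZMod N)ˣ) : ZMod N) = (((γ : SL(2, ℤ)) 0 0 : ℤ) : ZMod N) := by
  rw [← map_inv, val_toHomUnits]
  simp [Matrix.SpecialLinearGroup.coe_inv, Matrix.adjugate_fin_two]

/-- **`u_φ(γ) = -φ(a mod N)`** for `γ = (a b; c d)` (`ad ≡ 1 (mod N)`). [folklore] -/
theorem uClass_eq_neg (φ : (ZMod N)ˣ →* Multiplicative A) (γ : Gamma0 N) (w : (ZMod N)ˣ)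
    (hw : (w : ZMod N) = (((γ : SL(2, ℤ)) 0 0 : ℤ) : ZMod N)) :
    uClass N φ γ = -Multiplicative.toAdd (φ w) := by
  have : w = ((Gamma0Map N).toHomUnits γ)⁻¹ := Units.ext (by rw [hw, val_inv_toHomUnits])
  rw [this, map_inv, toAdd_inv, neg_neg]
  rfl

/-- **Every unit mod `N` is the `d`-entry of an element of `Γ₀(N)`.** [folklore] -/
theorem exists_toHomUnits_eq [NeZero N] (w : (ZMod N)ˣ) :
    ∃ γ : Gamma0 N, (Gamma0Map N).toHomUnits γ = w := by
  set d : ℤ := ((w : ZMod N).val : ℤ) with hd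
  set a : ℤ := (((w⁻¹ : (ZMod N)ˣ) : ZMod N).val : ℤ) with ha
  have hdw : (d : ZMod N) = w := by rw [hd, Int.cast_natCast, ZMod.natCast_zmod_val]
  have haw : (a : ZMod N) = ((w⁻¹ : (ZMod N)ˣ) : ZMod N) := by
    rw [ha, Int.cast_natCast, ZMod.natCast_zmod_val]
  have had : ((a * d - 1 : ℤ) : ZMod N) = 0 := by
    push_cast
    rw [hdw, haw, Units.inv_mul, sub_self]
  obtain ⟨k, hk⟩ := (ZMod.intCast_zmod_eq_zero_iff_dvd _ N).mp had
  refine ⟨⟨⟨!![a, k; (N : ℤ), d], ?_⟩, ?_⟩, ?_⟩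
  · rw [Matrix.det_fin_two_of]
    linear_combination hk
  · rw [Gamma0_mem]
    simp
  · apply Units.ext
    rw [val_toHomUnits, ← hdw]
    rfl

/-- **`u_φ` vanishes on the parabolic elements of `Γ₀(M)`, `M` prime** (`p` odd): a parabolic
`γ = (a b; c d) ∈ Γ₀(M)` has `(a + d)² = 4` and `ad ≡ 1`, so `(d ∓ 1)² ≡ 0`, `d ≡ ±1 (mod M)`, and
`φ(-1)` is killed by `2`. [cite: Mazur1977, II.2] -/
theorem gamma0Map_eq_or_of_isParabolic {M : ℕ} [Fact M.Prime] {γ : Gamma0 M}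
    (hγ : ((γ : SL(2, ℤ)) : Matrix (Fin 2) (Fin 2) ℤ).IsParabolic) :
    Gamma0Map M γ = 1 ∨ Gamma0Map M γ = -1 := by
  have hdisc := hγ.2
  rw [Matrix.discr_fin_two, Matrix.trace_fin_two, Matrix.SpecialLinearGroup.det_coe] at hdisc
  have hdet := Matrix.SpecialLinearGroup.det_coe (γ : SL(2, ℤ))
  rw [Matrix.det_fin_two] at hdet
  set a : ℤ := (γ : SL(2, ℤ)) 0 0
  set b : ℤ := (γ : SL(2, ℤ)) 0 1
  set c : ℤ := (γ : SL(2, ℤ)) 1 0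
  set d : ℤ := (γ : SL(2, ℤ)) 1 1
  have hc : (c : ZMod M) = 0 := by exact_mod_cast Gamma0_mem.mp γ.2
  have h1 : ((a : ZMod M) + d) ^ 2 = 4 := by
    have := congrArg (Int.cast : ℤ → ZMod M) hdisc
    push_cast at this
    linear_combination this
  have h2 : (a : ZMod M) * d - b * c = 1 := by
    have := congrArg (Int.cast : ℤ → ZMod M) hdet
    push_cast at this
    exact this
  have key : ((d : ZMod M) ^ 2 - 1) ^ 2 = 0 := by
    linear_combination (d : ZMod M) ^ 2 * h1 + (-((a : ZMod M) * d + 1) - 2 * d ^ 2) * h2 +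
      ((-((a : ZMod M) * d + 1) - 2 * d ^ 2) * b) * hc
  have key' : ((d : ZMod M) - 1) * (d + 1) = 0 := by
    have := pow_eq_zero_iff (two_ne_zero) |>.mp key
    linear_combination this
  rcases mul_eq_zero.mp key' with h | h
  · left
    exact sub_eq_zero.mp h
  · right
    exact eq_neg_of_add_eq_zero_left h

/-- **`u_φ(π) = 0` for parabolic `π ∈ Γ₀(M)`**, `M` prime, `φ` valued in `ℤ/pℤ`, `p` odd.
[cite: Mazur1977, II.2] -/
theorem uClass_eq_zero_of_isParabolic {M p : ℕ} [Fact M.Prime] [Fact p.Prime] (hp2 : p ≠ 2)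
    (φ : (ZMod M)ˣ →* Multiplicative (ZMod p)) {γ : Gamma0 M}
    (hγ : ((γ : SL(2, ℤ)) : Matrix (Fin 2) (Fin 2) ℤ).IsParabolic) : uClass M φ γ = 0 := by
  rcases gamma0Map_eq_or_of_isParabolic hγ with h | h
  · have e : (Gamma0Map M).toHomUnits γ = 1 := Units.ext h
    simp [uClass, e]
  · have e : (Gamma0Map M).toHomUnits γ = -1 := Units.ext (by rw [Units.val_neg, Units.val_one]; exact h)
    rw [uClass, e]
    set x := Multiplicative.toAdd (φ (-1))
    have hx : x + x = 0 := by
      rw [← toAdd_mul, ← map_mul, neg_mul_neg, one_mul, map_one, toAdd_one]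
    have hx2 : (2 : ZMod p) * x = 0 := by rw [two_mul, hx]
    rcases mul_eq_zero.mp hx2 with h0 | h0
    · exfalso
      apply hp2
      have h2 : ((2 : ℕ) : ZMod p) = 0 := by exact_mod_cast h0
      rw [ZMod.natCast_eq_zero_iff] at h2
      exact ((Nat.prime_dvd_prime_iff_eq Fact.out Nat.prime_two).mp h2)
    · exact h0

/-- **The Shimura class is a parabolic cocycle**: `u_φ ∈ H¹_P(Γ₀(M), 𝔽_p)` (`M` prime, `p` odd).
[cite: Mazur1977, II.2 and II.9] -/
theorem uClass_mem_parabolicHoms {M p : ℕ} [Fact M.Prime] [Fact p.Prime] (hp2 : p ≠ 2)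
    (φ : (ZMod M)ˣ →* Multiplicative (ZMod p)) :
    uClass M φ ∈ ParabolicCountK.parabolicHoms (ZMod p) M :=
  ⟨uClass_mul φ, fun _ hγ ↦ uClass_eq_zero_of_isParabolic hp2 φ hγ⟩

/-- **A character of `(ℤ/Mℤ)ˣ` onto `ℤ/pℤ` exists when `p ∣ M - 1`** (`(ℤ/Mℤ)ˣ` is cyclic of
order `M - 1`). [folklore] -/
theorem exists_character {M p : ℕ} [Fact M.Prime] [NeZero p] (hpM : p ∣ M - 1) :
    ∃ (φ : (ZMod M)ˣ →* Multiplicative (ZMod p)) (w : (ZMod M)ˣ), Multiplicative.toAdd (φ w) = 1 := by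
  have hcyc : IsCyclic (ZMod M)ˣ := inferInstance
  have hcard : Nat.card (ZMod M)ˣ = M - 1 := by rw [Nat.card_eq_fintype_card, ZMod.card_units]
  have hdvd : p ∣ Nat.card (ZMod M)ˣ := by rw [hcard]; exact hpM
  let e := zmodCyclicMulEquiv hcyc
  let c : ZMod (Nat.card (ZMod M)ˣ) →+* ZMod p := ZMod.castHom hdvd (ZMod p)
  refine ⟨(AddMonoidHom.toMultiplicative c.toAddMonoidHom).comp e.symm.toMonoidHom,
    e (Multiplicative.ofAdd 1), ?_⟩
  change c (Multiplicative.toAdd (e.symm (e (Multiplicative.ofAdd 1)))) = 1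
  rw [MulEquiv.symm_apply_apply]
  exact map_one c

/-- **`∑ⱼ u_φ(δⱼ) + u_φ(δ') = (ℓ + 1) u_φ(γ)`** for `ℓ ∤ N` prime: the `a`-entries of the `δⱼ`
are `a + jc ≡ a` except for the one `j` with `ℓ ∣ a + jc` (if `ℓ ∤ c`), where it is
`(a + jc)/ℓ ≡ a/ℓ`, and that of `δ'` is `ℓa` (if `ℓ ∤ c`) or `a` (if `ℓ ∣ c`, when no exceptional
`j` exists) — the Eisenstein eigenvalue `1 + ℓ` of `T_ℓ` on the Shimura class.
[cite: Mazur1977, II.9 (Eisenstein ideal: T_ℓ - 1 - ℓ)] -/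
theorem card_filter_dvd_eq_one {ℓ : ℕ} [NeZero ℓ] (hℓ : ℓ.Prime) {a c : ℤ} (hc : ¬ (ℓ : ℤ) ∣ c) :
    (Finset.univ.filter fun j : Fin ℓ ↦ (ℓ : ℤ) ∣ a + ((j : ℕ) : ℤ) * c).card = 1 := by
  haveI : Fact ℓ.Prime := ⟨hℓ⟩
  have hcu : (c : ZMod ℓ) ≠ 0 := by rwa [Ne, ZMod.intCast_zmod_eq_zero_iff_dvd]
  set z : ZMod ℓ := -(a : ZMod ℓ) * (c : ZMod ℓ)⁻¹ with hz
  have key : ∀ j : Fin ℓ, (ℓ : ℤ) ∣ a + ((j : ℕ) : ℤ) * c ↔ ((j : ℕ) : ZMod ℓ) = z := by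
    intro j
    rw [← ZMod.intCast_zmod_eq_zero_iff_dvd, hz, eq_mul_inv_iff_mul_eq₀ hcu]
    push_cast
    constructor <;> intro h <;> linear_combination h
  rw [Finset.card_eq_one]
  refine ⟨⟨z.val, z.val_lt⟩, ?_⟩
  ext j
  simp only [Finset.mem_filter, Finset.mem_univ, true_and, Finset.mem_singleton, key]
  constructor
  · intro h
    apply Fin.ext
    have h' : ((j : ℕ) : ZMod ℓ) = ((z.val : ℕ) : ZMod ℓ) := by rw [h, ZMod.natCast_zmod_val]
    rw [ZMod.natCast_eq_natCast_iff', Nat.mod_eq_of_lt j.2, Nat.mod_eq_of_lt z.val_lt] at h'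
    exact h'
  · rintro rfl
    exact ZMod.natCast_zmod_val z

variable {ℓ : ℕ}

/-- See `card_filter_dvd_eq_one`: the Hecke sum of the Shimura class. [cite: Mazur1977, II.9] -/
theorem sum_uClass_col [NeZero N] [NeZero ℓ] (hℓ : ℓ.Prime) (hℓN : ¬ ℓ ∣ N)
    (φ : (ZMod N)ˣ →* Multiplicative A) (γ : Gamma0 N) :
    ∑ j : Fin ℓ, uClass N φ (colB hℓ γ ((j : ℕ) : ℤ)) + uClass N φ (colD hℓ γ) =
      (ℓ + 1) • uClass N φ γ := by
  set a : ℤ := (γ : SL(2, ℤ)) 0 0 with ha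
  set c : ℤ := (γ : SL(2, ℤ)) 1 0 with hc
  have hcN : (c : ZMod N) = 0 := by exact_mod_cast Gamma0_mem.mp γ.2
  have hℓ0 : (ℓ : ℤ) ≠ 0 := by exact_mod_cast hℓ.ne_zero
  set Aγ : (ZMod N)ˣ := ((Gamma0Map N).toHomUnits γ)⁻¹ with hA
  have hAval : (Aγ : ZMod N) = (a : ZMod N) := val_inv_toHomUnits γ
  set L : (ZMod N)ˣ := ZMod.unitOfCoprime ℓ ((Nat.Prime.coprime_iff_not_dvd hℓ).mpr hℓN) with hL
  have hLval : (L : ZMod N) = (ℓ : ZMod N) := ZMod.coe_unitOfCoprime _ _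
  have hγv : uClass N φ γ = -Multiplicative.toAdd (φ Aγ) := uClass_eq_neg φ γ Aγ hAval
  have hB : ∀ j : ℤ, uClass N φ (colB hℓ γ j) =
      -Multiplicative.toAdd (φ Aγ) + if (ℓ : ℤ) ∣ a + j * c then Multiplicative.toAdd (φ L) else 0 := by
    intro j
    by_cases h : (ℓ : ℤ) ∣ a + j * c
    · rw [if_pos h, uClass_eq_neg φ _ (Aγ * L⁻¹) ?_]
      · rw [map_mul φ Aγ L⁻¹, map_inv φ L, toAdd_mul, toAdd_inv]
        abel
      · rw [(colB_apply_of_dvd hℓ γ j h).1]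
        obtain ⟨q, hq⟩ := h
        rw [show (γ : SL(2, ℤ)) 0 0 + j * (γ : SL(2, ℤ)) 1 0 = ℓ * q from hq,
          Int.mul_ediv_cancel_left _ hℓ0]
        have hq' : (ℓ : ZMod N) * q = a := by
          have := congrArg (Int.cast : ℤ → ZMod N) hq
          push_cast at this
          rw [hcN, mul_zero, add_zero] at this
          exact this.symm
        rw [Units.val_mul, hAval, ← hq', ← hLval, mul_comm (L : ZMod N) (q : ZMod N), mul_assoc,
          Units.mul_inv, mul_one]
    · rw [if_neg h, add_zero, uClass_eq_neg φ _ Aγ ?_]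
      rw [(colB_apply_of_not_dvd hℓ γ j h).1]
      push_cast
      rw [hcN, mul_zero, add_zero, hAval]
  have hD : uClass N φ (colD hℓ γ) =
      -Multiplicative.toAdd (φ Aγ) - if (ℓ : ℤ) ∣ c then 0 else Multiplicative.toAdd (φ L) := by
    by_cases h : (ℓ : ℤ) ∣ c
    · rw [if_pos h, sub_zero, uClass_eq_neg φ _ Aγ ?_]
      rw [(colD_apply_of_dvd hℓ hℓN γ h).1, hAval]
    · rw [if_neg h, uClass_eq_neg φ _ (L * Aγ) ?_]
      · rw [map_mul φ L Aγ, toAdd_mul]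
        abel
      · rw [(colD_apply_of_not_dvd hℓ γ h).1, Int.cast_mul, Int.cast_natCast, Units.val_mul, hLval, hAval]
  simp_rw [hB, hD]
  rw [Finset.sum_add_distrib, Finset.sum_const, Finset.card_univ, Fintype.card_fin, Finset.sum_ite,
    Finset.sum_const_zero, add_zero, Finset.sum_const, hγv, succ_nsmul]
  by_cases hdc : (ℓ : ℤ) ∣ c
  · -- no exceptional `j` (`ℓ ∣ c`, `ℓ ∤ a`)
    have hnone : ∀ j : Fin ℓ, ¬ (ℓ : ℤ) ∣ a + ((j : ℕ) : ℤ) * c := by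
      intro j hj
      have ha' : (ℓ : ℤ) ∣ a := by
        have := dvd_sub hj (dvd_mul_of_dvd_right hdc ((j : ℕ) : ℤ))
        rwa [add_sub_cancel_right] at this
      have hcop := Matrix.SpecialLinearGroup.isCoprime_col (γ : SL(2, ℤ)) 0
      exact (Nat.prime_iff_prime_int.mp hℓ).not_unit (hcop.isUnit_of_dvd' ha' hdc)
    rw [if_pos hdc, Finset.filter_false_of_mem (fun j _ ↦ hnone j), Finset.card_empty, zero_smul]
    abel
  · rw [if_neg hdc, card_filter_dvd_eq_one hℓ hdc, one_smul]
    abel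

end ShimuraClass

/-! ### 3. Mod-`p` parabolic cocycles of `Γ₀(N)` factor through `H₁(X₀(N), ℤ)` (`p ≥ 5`) -/

section Factor

variable {N : ℕ} [NeZero N]

/-- The **period map** `Γ₀(N) → H₁(X₀(N), ℤ) = periodHomology N`, `γ ↦ (h ↦ {∞, γ∞}_h)`.
[cite: CremonaAlgorithms1997, §2.1 (2.1.1)] -/
def per (γ : Gamma0 N) : periodHomology N :=
  ⟨periodFunctional N γ, periodFunctional_mem_periodHomology N γ⟩

/-- Unfolding `per`. [folklore] -/
@[simp] theorem coe_per (γ : Gamma0 N) :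
    (per γ : Module.Dual ℂ (CuspForm (Gamma0 N) 2)) = periodFunctional N γ := rfl

/-- Manin: `per(γδ) = per(γ) + per(δ)`. [cite: Manin1972, Prop. 1.4] -/
theorem per_mul (γ δ : Gamma0 N) : per (γ * δ) = per γ + per δ :=
  Subtype.ext (periodFunctional_mul N γ δ)

/-- Manin: the period map is onto `H₁(X₀(N), ℤ)`. [cite: CremonaAlgorithms1997, Lemma 2.1.1] -/
theorem per_surjective : Function.Surjective (per (N := N)) := by
  rintro ⟨x, hx⟩
  have hx' : x ∈ (periodHomology N : Set (Module.Dual ℂ (CuspForm (Gamma0 N) 2))) := hx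
  rw [coe_periodHomology_eq_range] at hx'
  obtain ⟨γ, rfl⟩ := hx'
  exact ⟨γ, rfl⟩

/-- The period of a parabolic element vanishes. [cite: Knapp1993, Prop. 11.1] -/
theorem per_eq_zero_of_isParabolic {γ : Gamma0 N}
    (hγ : ((γ : SL(2, ℤ)) : Matrix (Fin 2) (Fin 2) ℤ).IsParabolic) : per γ = 0 :=
  Subtype.ext (periodFunctional_eq_zero_of_isParabolic hγ)

/-- `H¹_P(Γ₀(N), K)` is finite-dimensional (it embeds in `Z¹(SL(2, ℤ), K^X)`). [folklore] -/
instance instFiniteParabolicHoms (K : Type*) [Field K] :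
    Module.Finite K (ParabolicCountK.parabolicHoms K N) :=
  Module.Finite.of_injective _ ParabolicCountK.liftHom_injective

/-- `2 ≠ 0` and `3 ≠ 0` in `𝔽_p` for `p ≥ 5`. [folklore] -/
theorem two_three_ne_zero {p : ℕ} [Fact p.Prime] (h5 : 5 ≤ p) : (2 : ZMod p) ≠ 0 ∧ (3 : ZMod p) ≠ 0 := by
  constructor
  · intro h
    have h' : ((2 : ℕ) : ZMod p) = 0 := by exact_mod_cast h
    rw [ZMod.natCast_eq_zero_iff] at h'
    have := Nat.le_of_dvd two_pos h'
    omega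
  · intro h
    have h' : ((3 : ℕ) : ZMod p) = 0 := by exact_mod_cast h
    rw [ZMod.natCast_eq_zero_iff] at h'
    have := Nat.le_of_dvd (by norm_num) h'
    omega

/-- **Every `𝔽_p`-valued parabolic cocycle of `Γ₀(N)` factors through the period homology**
(`p ≥ 5`, `N ≥ 1`): `Hom(H₁(X₀(N), ℤ), 𝔽_p) → H¹_P(Γ₀(N), 𝔽_p)`, `ū ↦ ū ∘ per`, is onto (it is
injective by Manin's surjectivity, and both sides have dimension `2g`: `H₁ ≅ ℤ^{2g}` by the tree's
`periodHomology_eq_span_basis_holds`, `dim H¹_P(Γ₀(N), 𝔽_p) ≤ 2g` by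
`ParabolicCountK.finrank_parabolicHoms_le`) — Knapp's `H₁(X₀(N), ℤ) ≅ Γ₀(N)ᵃᵇ/Γ_epᵃᵇ` modulo `p`.
[cite: Knapp1993, Prop. 11.22] [cite: ShimuraIATAF1971, §8.2 (8.2.23)] -/
theorem exists_addMonoidHom_comp_per {p : ℕ} [Fact p.Prime] (h5 : 5 ≤ p) {u : Gamma0 N → ZMod p}
    (hu : u ∈ ParabolicCountK.parabolicHoms (ZMod p) N) :
    ∃ ū : periodHomology N →+ ZMod p, ∀ γ, ū (per γ) = u γ := by
  obtain ⟨n, b, hb⟩ := periodHomology_eq_span_basis_holds N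
  -- integer coordinates on `H`
  have hint : ∀ (x : periodHomology N) (i : Fin n), ∃ z : ℤ, (z : ℝ) = b.repr x.1 i := by
    intro x i
    have hx : (x.1 : Module.Dual ℂ (CuspForm (Gamma0 N) 2)) ∈
        (Submodule.span ℤ (Set.range b) : Set (Module.Dual ℂ (CuspForm (Gamma0 N) 2))) := by
      rw [← hb]
      exact x.2
    obtain ⟨z, hz⟩ := (b.mem_span_iff_repr_mem ℤ x.1).mp hx i
    exact ⟨z, by simpa using hz⟩
  choose zc hzc using hint
  have hzc_add : ∀ x y i, zc (x + y) i = zc x i + zc y i := by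
    intro x y i
    apply Int.cast_injective (α := ℝ)
    push_cast
    rw [hzc, hzc, hzc, AddMemClass.coe_add, map_add, Finsupp.add_apply]
  have hzc_zero : ∀ i, zc 0 i = 0 := by
    intro i
    apply Int.cast_injective (α := ℝ)
    rw [hzc]
    simp
  -- the mod-`p` coordinate cocycles
  set χ : Fin n → Gamma0 N → ZMod p := fun i γ ↦ ((zc (per γ) i : ℤ) : ZMod p) with hχ_def
  have hχ : ∀ i, χ i ∈ ParabolicCountK.parabolicHoms (ZMod p) N := fun i ↦ by
    refine ⟨fun γ δ ↦ ?_, fun γ hγ ↦ ?_⟩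
    · simp only [hχ_def, per_mul, hzc_add, Int.cast_add]
    · simp only [hχ_def, per_eq_zero_of_isParabolic hγ, hzc_zero, Int.cast_zero]
  -- generators `γ_j` with `per γ_j = b j`
  have hbj : ∀ j, (b j : Module.Dual ℂ (CuspForm (Gamma0 N) 2)) ∈ periodHomology N := fun j ↦ by
    have : (b j : Module.Dual ℂ (CuspForm (Gamma0 N) 2)) ∈
        (Submodule.span ℤ (Set.range b) : Set (Module.Dual ℂ (CuspForm (Gamma0 N) 2))) :=
      Submodule.subset_span ⟨j, rfl⟩
    rw [← hb] at this
    exact this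
  have hγ : ∀ j, ∃ γ : Gamma0 N, per γ = ⟨b j, hbj j⟩ := fun j ↦ per_surjective _
  choose g hg using hγ
  have hχg : ∀ i j, χ i (g j) = if j = i then 1 else 0 := by
    intro i j
    have h1 : (zc (per (g j)) i : ℝ) = if j = i then 1 else 0 := by
      rw [hzc, hg]
      simp [Finsupp.single_apply]
    have h2 : zc (per (g j)) i = if j = i then 1 else 0 := by
      apply Int.cast_injective (α := ℝ)
      rw [h1]
      split_ifs <;> simp
    simp only [hχ_def, h2]
    split_ifs <;> simp
  -- linear independence in `P`
  set v : Fin n → ParabolicCountK.parabolicHoms (ZMod p) N := fun i ↦ ⟨χ i, hχ i⟩ with hv_def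
  have hv : LinearIndependent (ZMod p) v := by
    rw [Fintype.linearIndependent_iff]
    intro c hc j
    have h1 := congr_fun (congrArg Subtype.val hc) (g j)
    simp only [Submodule.coe_sum, Submodule.coe_smul, Finset.sum_apply, Pi.smul_apply, smul_eq_mul,
      Submodule.coe_zero, Pi.zero_apply, hv_def, hχg, mul_ite, mul_one, mul_zero,
      Finset.sum_ite_eq, Finset.mem_univ, if_true] at h1
    exact h1
  -- dimension count: `n = 2 dim S₂ ≥ dim P ≥ n`
  obtain ⟨h2, h3⟩ := two_three_ne_zero h5
  have hle := ParabolicCountK.finrank_parabolicHoms_le (K := ZMod p) (N := N) h2 h3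
  have hn : n = 2 * Module.finrank ℂ (CuspForm (Gamma0 N) 2) := by
    have h1 := Module.finrank_eq_card_basis b
    rw [Fintype.card_fin, finrank_real_of_complex, Subspace.dual_finrank_eq] at h1
    omega
  have hge := hv.fintype_card_le_finrank
  rw [Fintype.card_fin] at hge
  have hcard : Fintype.card (Fin n) = Module.finrank (ZMod p) (ParabolicCountK.parabolicHoms (ZMod p) N) := by
    rw [Fintype.card_fin]
    omega
  have hspan := hv.span_eq_top_of_card_eq_finrank' hcard
  -- `u` in the span
  have humem : (⟨u, hu⟩ : ParabolicCountK.parabolicHoms (ZMod p) N) ∈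
      Submodule.span (ZMod p) (Set.range v) := by
    rw [hspan]
    exact Submodule.mem_top
  obtain ⟨c, hc⟩ := (Submodule.mem_span_range_iff_exists_fun (ZMod p)).mp humem
  -- the factorisation `ū(x) = ∑ cᵢ (coordᵢ x mod p)`
  refine ⟨{ toFun := fun x ↦ ∑ i, c i * ((zc x i : ℤ) : ZMod p)
            map_zero' := by simp [hzc_zero]
            map_add' := fun x y ↦ by
              simp only [hzc_add, Int.cast_add, mul_add, Finset.sum_add_distrib] }, fun γ ↦ ?_⟩
  have h1 := congr_fun (congrArg Subtype.val hc) γ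
  simp only [Submodule.coe_sum, Submodule.coe_smul, Finset.sum_apply, Pi.smul_apply, smul_eq_mul,
    hv_def] at h1
  exact h1

end Factor

/-! ### 4. Prime level `M`, `p ∣ M - 1`: the Eisenstein covector on `H₁(X₀(M), ℤ)` -/

section PrimeLevel

variable {M : ℕ} [Fact M.Prime] [NeZero M] {p : ℕ} [Fact p.Prime]

/-- **Hecke transport**: if `ū ∘ per = u_φ` then `ū(T_ℓ^∨ x) = (ℓ + 1) ū(x)` on `H₁(X₀(M), ℤ)` for
every prime `ℓ ≠ M`. [cite: Mazur1977, II.9] -/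
theorem addMonoidHom_dualMap_heckeT {A : Type*} [AddCommGroup A] {ū : periodHomology M →+ A}
    {φ : (ZMod M)ˣ →* Multiplicative A} (hū : ∀ γ, ū (per γ) = uClass M φ γ)
    {ℓ : ℕ} [NeZero ℓ] (hℓ : ℓ.Prime) (hℓM : ¬ ℓ ∣ M) (x : periodHomology M) :
    ū ⟨(heckeT (Gamma0 M) 2 ℓ).dualMap x.1, dualMap_heckeT_mem_periodHomology M hℓ x.2⟩ =
      (ℓ + 1) • ū x := by
  obtain ⟨γ, rfl⟩ := per_surjective x
  have key : (⟨(heckeT (Gamma0 M) 2 ℓ).dualMap (per γ).1,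
      dualMap_heckeT_mem_periodHomology M hℓ (per γ).2⟩ : periodHomology M) =
        ∑ j : Fin ℓ, per (colB hℓ γ ((j : ℕ) : ℤ)) + per (colD hℓ γ) := by
    apply Subtype.ext
    simp only [coe_per, dualMap_heckeT_periodFunctional_eq hℓ γ, if_neg hℓM, AddMemClass.coe_add,
      AddSubmonoidClass.coe_finsetSum]
  rw [key, map_add, map_sum]
  simp_rw [hū]
  exact sum_uClass_col hℓ hℓM φ γ

/-- **The Eisenstein covector** (Mazur's Shimura class on the period homology).  Let `M` and
`p ≥ 5` be primes with `p ∣ M - 1`.  There is a non-zero additive map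
`ū : H₁(X₀(M), ℤ) → 𝔽_p` (the period homology `periodHomology M ⊆ S₂(Γ₀(M))^∨`) with
`ū ∘ T_ℓ^∨ = (1 + ℓ) ū` for every prime `ℓ ≠ M` — i.e. the Eisenstein maximal ideal
`(p, T_ℓ - 1 - ℓ)` of the Hecke algebra is in the support of `H₁(X₀(M), 𝔽_p)`; obtained without
`q`-expansions, from the Shimura class `γ ↦ φ(d)` (`φ : (ℤ/M)ˣ ↠ ℤ/p`), which is a non-zero
parabolic `𝔽_p`-cocycle with `T_ℓ`-eigenvalue `1 + ℓ`, and the factorisation of mod-`p` parabolic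
cocycles through `H₁` (Shapiro + `PSL₂(ℤ) = ℤ/2 ∗ ℤ/3` count). This is the homological input to
Mazur's theorem that `p` is an Eisenstein prime for `J₀(M)` (Mazur 1977, Prop. II.9.7, II.5.12)
and to the `(N, k) = (1, 2)` case of Billerey–Menares 2018, Thm. 1.
[cite: Mazur1977, II.9 Prop. 9.7 and II.11] -/
theorem exists_eisensteinCovector (h5 : 5 ≤ p) (hpM : p ∣ M - 1) :
    ∃ ū : periodHomology M →+ ZMod p, ū ≠ 0 ∧
      ∀ (ℓ : ℕ) [NeZero ℓ], ℓ.Prime → ¬ ℓ ∣ M → ∀ x y : periodHomology M,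
        (y : Module.Dual ℂ (CuspForm (Gamma0 M) 2)) = (heckeT (Gamma0 M) 2 ℓ).dualMap x →
          ū y = (ℓ + 1) • ū x := by
  have hp2 : p ≠ 2 := by omega
  obtain ⟨φ, w, hw⟩ := exists_character (M := M) (p := p) hpM
  obtain ⟨ū, hū⟩ := exists_addMonoidHom_comp_per h5 (uClass_mem_parabolicHoms hp2 φ)
  refine ⟨ū, ?_, ?_⟩
  · obtain ⟨γ, hγ⟩ := exists_toHomUnits_eq (N := M) w
    intro h0
    have h1 := hū γ
    rw [h0, AddMonoidHom.zero_apply, uClass, hγ, hw] at h1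
    exact zero_ne_one h1
  · intro ℓ _ hℓ hℓM x y hy
    have : y = ⟨(heckeT (Gamma0 M) 2 ℓ).dualMap x.1, dualMap_heckeT_mem_periodHomology M hℓ x.2⟩ :=
      Subtype.ext hy
    rw [this]
    exact addMonoidHom_dualMap_heckeT hū hℓ hℓM x

end PrimeLevel

end EisensteinCovector

end Literature.NumberTheory.ModularForms
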